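import Summits.QuantumFields.YangMills.Theorems.BalabanUVNodesN15KingModelFullPropagatorGradRiemannWeightedRate
import Summits.QuantumFields.YangMills.Theorems.BalabanUVNodesN15KingModelPotentialDressedDecayGrad
import Summits.QuantumFields.YangMills.Theorems.BalabanUVNodesN15KingModelPotentialDressedMinimiserStep
import Summits.QuantumFields.YangMills.Theorems.BalabanUVNodesN18KingModelTorusDeriv

/-!
# N15 (NE2⁺), King-model rung, part 18d: King's Prop. 3.8 (3.71) LINE 2 for the DRESSED minimiser — the two-run inequality

Cell `pub-ymgap-dag-n15-d` (R134 acceleration DAG, node N15 = NE2, strategy s3 KING-MODEL RUNG), part 18d.  (3.71) has two lines: the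
two-spacing step of the minimiser and of its lattice GRADIENT.  Part 14 proved line 1 for the dressed minimiser `ℋ_w`; this file proves the two-run inequality behind line 2 and its undressed letter:

* §1 ★ `kingHPot_grad_step` — differencing the two runs' fixed points in the observation point and moving the coarse middle sum to the finer
  lattice (`avg_comp_underPtN`): `∂′ℋ′_{w′}(x′) − ∂ℋ_w(x) = [∂′ℋ′(x′) − ∂ℋ(x)] − N′^{−(d+1)}Σ_{u′}[∂′G′(x′,u′)w′(u′)ℋ′_{w′}(u′) − ∂G(x,u)w(u)ℋ_w(u)]`
  (`x, u` under `x′, u′`); telescoping the bracket, the LAST factor is the VALUE step of the dressed minimiser (part 14), so NO Neumann step is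
  needed: with the undressed gradient step `D₀`, the weighted gradient mass `C_W` (18a) and rate `R_W` (18c), `|w|, |w′| ≤ w₀`, coherence `ν`, the
  dressed decay `H′` (11d) and the weighted dressed value step `S` (14):
  `|∂′ℋ′_{w′}(x′, b) − ∂ℋ_w(x, b)| ≤ (D₀ + R_W·w₀H′ + C_W·(νH′ + w₀S))·e^{−δ′|B(x′) − b|}`;
* §2 `dkingH_step_kingU` — the undressed line 2 on the King-admissible tori, uniformly (the tree's `King1986.Torus.king_prop38_deriv_torus_blocks`
  + n18's `douterRate_le_unif` BY NAME, as n15-e's `dkingHStepAt_le`; `0 ≤ γ < 1`);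
* SUCCESSOR STEP (not in this file): the run corollary `dkingHPot_step_kingU` — feed §1 with §2 (`D₀`), part 18a (`C_W`), part 18c (`R_W`),
  part 11d (`H′`), part 14 (`S`) in part 9c's window, exactly as part 14 assembled line 1; every letter is already in the tree.

HONEST SCOPE.  King's A = 0 scalar model, King-admissible tori, odd `L ≥ 3`, `a, m² > 0`; scalar potentials (not gauge fields); count-neutral
(`--supports`), not a discharge of N15, nothing in `YMDAG.*` touched; §1 is the two-run inequality with numerical letters, §2 the undressed letter.

References: C. King, Commun. Math. Phys. 103 (1986) 323–349, (2.13) p.653, Theorem 3.3 (3.7) p.658, Prop. 3.8 (3.71) p.664 (bib key `King1986`).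
-/

noncomputable section
open scoped BigOperators Matrix
open Finset

namespace Summit.QuantumFields.YangMills.BalabanUVNodes.N15.KingModel

open Literature.MathematicalPhysics.QuantumFieldTheory.Balaban1983to89 hiding blockOf
open Literature.MathematicalPhysics.QuantumFieldTheory.Balaban1983to89.B5Prop11Plancherel (Tor fine unitVec)
open Literature.MathematicalPhysics.QuantumFieldTheory.King1986 (aK aK_pos dprop38RateConst dprop38PosConst lemma43Const)
open Literature.MathematicalPhysics.QuantumFieldTheory.King1986.Torus
open Summit.QuantumFields.YangMills.BalabanUVNodes.N15KingModelRung (kingH)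
open Summit.QuantumFields.YangMills.BalabanUVNodes.N15KingModelRung.Curved (underPtN val_underPtN blockOf_underPtN)
open Summit.QuantumFields.YangMills.BalabanUVNodes.N18KingModelTorusDeriv (douterRate_le_unif)

variable {d : ℕ}

/-! ## §1 The gradient two-spacing step of the dressed minimiser -/

section GradStep

variable (L : ℕ) [NeZero L] {U : Fin (d + 1) → ℕ} [∀ μ, NeZero (U μ)] {a m2 : ℝ}

/-- **THE GRADIENT TWO-SPACING STEP OF THE DRESSED MINIMISER** (module docstring, §1): two runs `L^k`, `L·L^k` over `U`, potentials `w, w′`, a block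
`b`, a direction `μ`; numerical letters `D₀` (undressed gradient step with decay), `C_W` (weighted gradient mass of `G`, coarse run), `R_W` (weighted
gradient rate of the pair), `H′` (weighted dressed decay, finer run), `S` (weighted dressed VALUE step), `|w|, |w′| ≤ w₀`, coherence `ν`, `δ′ ≥ 0`.  Then
`|N′·(ℋ′_{w′}(x′+e_μ, b) − ℋ′_{w′}(x′, b)) − N·(ℋ_w(x+e_μ, b) − ℋ_w(x, b))| ≤ (D₀ + R_W·(w₀H′) + C_W·(νH′ + w₀S))·e^{−δ′|B(x′) − b|}` (`x` under `x′`).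
[cite: King1986, (2.13) p.653, Prop. 3.8 (3.71) p.664 (second line), p.664 (pairing)] -/
theorem kingHPot_grad_step {k : ℕ} (hak : 0 ≤ aK a L k) (hak' : 0 ≤ aK a L (k + 1)) (hm : 0 < m2)
    {w : Tor (fine (L ^ k) U) → ℝ} {w' : Tor (fine (L ^ 1 * L ^ k) U) → ℝ}
    (hB : IsUnit (fineOpPot (L ^ k) U (aK a L k) (((L ^ k : ℕ) : ℝ) ^ 2) m2 w))
    (hB' : IsUnit (fineOpPot (L ^ 1 * L ^ k) U (aK a L (k + 1)) (((L ^ 1 * L ^ k : ℕ) : ℝ) ^ 2) m2 w'))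
    (b : Tor U) (μ : Fin (d + 1)) {D0 CW RW w₀ ν H' S δ' : ℝ} (hH'0 : 0 ≤ H') (hS0 : 0 ≤ S) (hδ' : 0 ≤ δ')
    (hstep0 : ∀ x' : Tor (fine (L ^ 1 * L ^ k) U),
      |((L ^ 1 * L ^ k : ℕ) : ℝ) * (kingH L (L ^ 1 * L ^ k) U a m2 (k + 1) b (x' + unitVec (fine (L ^ 1 * L ^ k) U) μ)
            - kingH L (L ^ 1 * L ^ k) U a m2 (k + 1) b x')
        - ((L ^ k : ℕ) : ℝ) * (kingH L (L ^ k) U a m2 k b (underPtN L k 1 U x' + unitVec (fine (L ^ k) U) μ)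
            - kingH L (L ^ k) U a m2 k b (underPtN L k 1 U x'))|
        ≤ D0 * Real.exp (-(δ' * tdistT U (blockOf (L ^ 1 * L ^ k) U x') b)))
    (hmassDW : ∀ x : Tor (fine (L ^ k) U), (((L ^ k : ℕ) : ℝ) ^ (d + 1))⁻¹ *
      ∑ u, |((L ^ k : ℕ) : ℝ) * (constrainedProp (L ^ k) U (aK a L k) (((L ^ k : ℕ) : ℝ) ^ 2) m2 (x + unitVec (fine (L ^ k) U) μ) u
          - constrainedProp (L ^ k) U (aK a L k) (((L ^ k : ℕ) : ℝ) ^ 2) m2 x u)|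
        * Real.exp (δ' * tdistT U (blockOf (L ^ k) U x) (blockOf (L ^ k) U u)) ≤ CW)
    (hrateDW : ∀ x' : Tor (fine (L ^ 1 * L ^ k) U), (((L ^ 1 * L ^ k : ℕ) : ℝ) ^ (d + 1))⁻¹ *
      ∑ u', |((L ^ 1 * L ^ k : ℕ) : ℝ) *
            (constrainedProp (L ^ 1 * L ^ k) U (aK a L (k + 1)) (((L ^ 1 * L ^ k : ℕ) : ℝ) ^ 2) m2
                (x' + unitVec (fine (L ^ 1 * L ^ k) U) μ) u'
              - constrainedProp (L ^ 1 * L ^ k) U (aK a L (k + 1)) (((L ^ 1 * L ^ k : ℕ) : ℝ) ^ 2) m2 x' u')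
          - ((L ^ k : ℕ) : ℝ) *
            (constrainedProp (L ^ k) U (aK a L k) (((L ^ k : ℕ) : ℝ) ^ 2) m2 (underPtN L k 1 U x' + unitVec (fine (L ^ k) U) μ)
                (underPtN L k 1 U u')
              - constrainedProp (L ^ k) U (aK a L k) (((L ^ k : ℕ) : ℝ) ^ 2) m2 (underPtN L k 1 U x') (underPtN L k 1 U u'))|
        * Real.exp (δ' * tdistT U (blockOf (L ^ 1 * L ^ k) U x') (blockOf (L ^ 1 * L ^ k) U u')) ≤ RW)
    (hw : ∀ y, |w y| ≤ w₀) (hw' : ∀ y', |w' y'| ≤ w₀) (hcoh : ∀ y', |w' y' - w (underPtN L k 1 U y')| ≤ ν)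
    (hH' : ∀ u' : Tor (fine (L ^ 1 * L ^ k) U),
      |kingHPot L (L ^ 1 * L ^ k) U a m2 (k + 1) w' b u'| ≤ H' * Real.exp (-(δ' * tdistT U (blockOf (L ^ 1 * L ^ k) U u') b)))
    (hS : ∀ u' : Tor (fine (L ^ 1 * L ^ k) U),
      |kingHPot L (L ^ 1 * L ^ k) U a m2 (k + 1) w' b u' - kingHPot L (L ^ k) U a m2 k w b (underPtN L k 1 U u')|
        ≤ S * Real.exp (-(δ' * tdistT U (blockOf (L ^ 1 * L ^ k) U u') b)))
    (x' : Tor (fine (L ^ 1 * L ^ k) U)) :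
    |((L ^ 1 * L ^ k : ℕ) : ℝ) * (kingHPot L (L ^ 1 * L ^ k) U a m2 (k + 1) w' b (x' + unitVec (fine (L ^ 1 * L ^ k) U) μ)
          - kingHPot L (L ^ 1 * L ^ k) U a m2 (k + 1) w' b x')
      - ((L ^ k : ℕ) : ℝ) * (kingHPot L (L ^ k) U a m2 k w b (underPtN L k 1 U x' + unitVec (fine (L ^ k) U) μ)
          - kingHPot L (L ^ k) U a m2 k w b (underPtN L k 1 U x'))|
      ≤ (D0 + RW * (w₀ * H') + CW * (ν * H' + w₀ * S)) * Real.exp (-(δ' * tdistT U (blockOf (L ^ 1 * L ^ k) U x') b)) := by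
  have hw₀ : 0 ≤ w₀ := nonneg_of_abs_le hw
  have hν : 0 ≤ ν := (abs_nonneg _).trans (hcoh fun _ => 0)
  have hN'pos : (0 : ℝ) < (((L ^ 1 * L ^ k : ℕ) : ℝ)) ^ (d + 1) := pow_pos (Nat.cast_pos.mpr (Nat.pos_of_ne_zero (NeZero.ne _))) _
  set μ' : ℝ := ((((L ^ 1 * L ^ k : ℕ) : ℝ)) ^ (d + 1))⁻¹ with hμ'def
  have hμ'0 : 0 ≤ μ' := inv_nonneg.mpr hN'pos.le
  set G := constrainedProp (L ^ k) U (aK a L k) (((L ^ k : ℕ) : ℝ) ^ 2) m2 with hGdef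
  set G' := constrainedProp (L ^ 1 * L ^ k) U (aK a L (k + 1)) (((L ^ 1 * L ^ k : ℕ) : ℝ) ^ 2) m2 with hG'def
  set x := underPtN L k 1 U x' with hxdef
  set E : ℝ := Real.exp (-(δ' * tdistT U (blockOf (L ^ 1 * L ^ k) U x') b)) with hEdef
  have hE : 0 < E := Real.exp_pos _
  -- the differentiated kernels of the two runs (the coarse one read on the finer lattice)
  set DG' : Tor (fine (L ^ 1 * L ^ k) U) → ℝ := fun u' =>
    ((L ^ 1 * L ^ k : ℕ) : ℝ) * (G' (x' + unitVec (fine (L ^ 1 * L ^ k) U) μ) u' - G' x' u') with hDG'def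
  set DG : Tor (fine (L ^ 1 * L ^ k) U) → ℝ := fun u' =>
    ((L ^ k : ℕ) : ℝ) * (G (x + unitVec (fine (L ^ k) U) μ) (underPtN L k 1 U u') - G x (underPtN L k 1 U u')) with hDGdef
  set h' : Tor (fine (L ^ 1 * L ^ k) U) → ℝ := fun u' => kingHPot L (L ^ 1 * L ^ k) U a m2 (k + 1) w' b u' with hh'def
  set h : Tor (fine (L ^ 1 * L ^ k) U) → ℝ := fun u' => kingHPot L (L ^ k) U a m2 k w b (underPtN L k 1 U u') with hhdef
  -- §a the fine run's differenced fixed point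
  have e1 : ∀ (S1 S0 H1 H0 c ρ : ℝ), c * ((H1 - ρ * S1) - (H0 - ρ * S0)) = c * (H1 - H0) - (c * ρ * S1 - c * ρ * S0) := by
    intros; ring
  have hfine : ((L ^ 1 * L ^ k : ℕ) : ℝ) * (kingHPot L (L ^ 1 * L ^ k) U a m2 (k + 1) w' b (x' + unitVec (fine (L ^ 1 * L ^ k) U) μ)
        - kingHPot L (L ^ 1 * L ^ k) U a m2 (k + 1) w' b x')
      = ((L ^ 1 * L ^ k : ℕ) : ℝ) * (kingH L (L ^ 1 * L ^ k) U a m2 (k + 1) b (x' + unitVec (fine (L ^ 1 * L ^ k) U) μ)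
          - kingH L (L ^ 1 * L ^ k) U a m2 (k + 1) b x')
        - μ' * ∑ u', DG' u' * w' u' * h' u' := by
    rw [kingHPot_fixedPoint (L := L) hak' hm hB' b (x' + unitVec (fine (L ^ 1 * L ^ k) U) μ),
      kingHPot_fixedPoint (L := L) hak' hm hB' b x', e1, ← mul_sub, ← sum_sub_distrib, mul_sum, mul_sum]
    congr 1
    exact sum_congr rfl fun u' _ => by simp only [hDG'def, hh'def]; ring
  -- §b the coarse run's differenced fixed point, its middle sum moved to the finer lattice
  have hcoarse : ((L ^ k : ℕ) : ℝ) * (kingHPot L (L ^ k) U a m2 k w b (x + unitVec (fine (L ^ k) U) μ) - kingHPot L (L ^ k) U a m2 k w b x)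
      = ((L ^ k : ℕ) : ℝ) * (kingH L (L ^ k) U a m2 k b (x + unitVec (fine (L ^ k) U) μ) - kingH L (L ^ k) U a m2 k b x)
        - μ' * ∑ u', DG u' * w (underPtN L k 1 U u') * h u' := by
    have hmove : (((L ^ k : ℕ) : ℝ) ^ (d + 1))⁻¹ * ∑ u, ((L ^ k : ℕ) : ℝ) * (G (x + unitVec (fine (L ^ k) U) μ) u - G x u) * w u
          * kingHPot L (L ^ k) U a m2 k w b u
        = μ' * ∑ u', DG u' * w (underPtN L k 1 U u') * h u' :=
      (avg_comp_underPtN L U k (fun u => ((L ^ k : ℕ) : ℝ) * (G (x + unitVec (fine (L ^ k) U) μ) u - G x u) * w u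
        * kingHPot L (L ^ k) U a m2 k w b u)).symm
    rw [kingHPot_fixedPoint (L := L) hak hm hB b (x + unitVec (fine (L ^ k) U) μ), kingHPot_fixedPoint (L := L) hak hm hB b x, e1,
      ← mul_sub, ← sum_sub_distrib, ← hmove, mul_sum, mul_sum]
    congr 1
    exact sum_congr rfl fun u _ => by ring
  -- §c the difference, telescoped and weighted
  have hsplit : ∀ u' : Tor (fine (L ^ 1 * L ^ k) U), Real.exp (-(δ' * tdistT U (blockOf (L ^ 1 * L ^ k) U u') b))
      ≤ Real.exp (δ' * tdistT U (blockOf (L ^ 1 * L ^ k) U x') (blockOf (L ^ 1 * L ^ k) U u')) * E := fun u' => by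
    rw [hEdef, ← Real.exp_add]
    exact Real.exp_le_exp.mpr (by nlinarith [(tdistT_isPseudoDist U).triangle (blockOf (L ^ 1 * L ^ k) U x') (blockOf (L ^ 1 * L ^ k) U u') b])
  set Wt : Tor (fine (L ^ 1 * L ^ k) U) → ℝ := fun u' =>
    Real.exp (δ' * tdistT U (blockOf (L ^ 1 * L ^ k) U x') (blockOf (L ^ 1 * L ^ k) U u')) with hWtdef
  have hWt0 : ∀ u', 0 ≤ Wt u' := fun u' => (Real.exp_pos _).le
  have hterm : ∀ u', |DG' u' * w' u' * h' u' - DG u' * w (underPtN L k 1 U u') * h u'|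
      ≤ (|DG' u' - DG u'| * Wt u' * (w₀ * H') + |DG u'| * Wt u' * (ν * H' + w₀ * S)) * E := by
    intro u'
    have htel := abs_kernel3_sub_le (DG u') (DG' u') (w (underPtN L k 1 U u')) (w' u') (h u') (h' u')
    have hh' : |h' u'| ≤ H' * (Wt u' * E) := (hH' u').trans (mul_le_mul_of_nonneg_left (hsplit u') hH'0)
    have hhS : |h' u' - h u'| ≤ S * (Wt u' * E) := (hS u').trans (mul_le_mul_of_nonneg_left (hsplit u') hS0)
    have a1 : |DG' u' - DG u'| * |w' u'| * |h' u'| ≤ |DG' u' - DG u'| * w₀ * (H' * (Wt u' * E)) :=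
      mul_le_mul (mul_le_mul_of_nonneg_left (hw' u') (abs_nonneg _)) hh' (abs_nonneg _) (by positivity)
    have a2 : |w' u' - w (underPtN L k 1 U u')| * |h' u'| ≤ ν * (H' * (Wt u' * E)) :=
      mul_le_mul (hcoh u') hh' (abs_nonneg _) hν
    have a3 : |w (underPtN L k 1 U u')| * |h' u' - h u'| ≤ w₀ * (S * (Wt u' * E)) :=
      mul_le_mul (hw _) hhS (abs_nonneg _) hw₀
    have a4 : |DG u'| * (|w' u' - w (underPtN L k 1 U u')| * |h' u'| + |w (underPtN L k 1 U u')| * |h' u' - h u'|)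
        ≤ |DG u'| * (ν * (H' * (Wt u' * E)) + w₀ * (S * (Wt u' * E))) :=
      mul_le_mul_of_nonneg_left (add_le_add a2 a3) (abs_nonneg _)
    calc |DG' u' * w' u' * h' u' - DG u' * w (underPtN L k 1 U u') * h u'|
        ≤ |DG' u' - DG u'| * |w' u'| * |h' u'|
          + |DG u'| * (|w' u' - w (underPtN L k 1 U u')| * |h' u'| + |w (underPtN L k 1 U u')| * |h' u' - h u'|) := htel
      _ ≤ |DG' u' - DG u'| * w₀ * (H' * (Wt u' * E)) + |DG u'| * (ν * (H' * (Wt u' * E)) + w₀ * (S * (Wt u' * E))) :=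
          add_le_add a1 a4
      _ = _ := by ring
  -- the weighted coarse gradient mass read on the finer lattice
  have hmoveAbs : μ' * ∑ u', |DG u'| * Wt u'
      = (((L ^ k : ℕ) : ℝ) ^ (d + 1))⁻¹ * ∑ u, |((L ^ k : ℕ) : ℝ) * (G (x + unitVec (fine (L ^ k) U) μ) u - G x u)|
          * Real.exp (δ' * tdistT U (blockOf (L ^ k) U x) (blockOf (L ^ k) U u)) := by
    rw [← avg_comp_underPtN L U k (fun u => |((L ^ k : ℕ) : ℝ) * (G (x + unitVec (fine (L ^ k) U) μ) u - G x u)|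
      * Real.exp (δ' * tdistT U (blockOf (L ^ k) U x) (blockOf (L ^ k) U u)))]
    refine congrArg _ (sum_congr rfl fun u' _ => ?_)
    simp only [hDGdef, hWtdef, hxdef, blockOf_underPtN]
  rw [hfine, hcoarse]
  have ereg : ∀ (A1 A0 P Q : ℝ), (A1 - P) - (A0 - Q) = (A1 - A0) - (P - Q) := fun _ _ _ _ => by ring
  rw [ereg, ← mul_sub, ← sum_sub_distrib]
  refine (abs_sub _ _).trans ?_
  have hsumle : |μ' * ∑ u', (DG' u' * w' u' * h' u' - DG u' * w (underPtN L k 1 U u') * h u')|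
      ≤ (RW * (w₀ * H') + CW * (ν * H' + w₀ * S)) * E := by
    rw [abs_mul, abs_of_nonneg hμ'0]
    calc μ' * |∑ u', (DG' u' * w' u' * h' u' - DG u' * w (underPtN L k 1 U u') * h u')|
        ≤ μ' * ∑ u', (|DG' u' - DG u'| * Wt u' * (w₀ * H') + |DG u'| * Wt u' * (ν * H' + w₀ * S)) * E :=
          mul_le_mul_of_nonneg_left ((abs_sum_le_sum_abs _ _).trans (sum_le_sum fun u' _ => hterm u')) hμ'0
      _ = ((μ' * ∑ u', |DG' u' - DG u'| * Wt u') * (w₀ * H') + (μ' * ∑ u', |DG u'| * Wt u') * (ν * H' + w₀ * S)) * E := by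
          rw [← sum_mul, sum_add_distrib, ← sum_mul, ← sum_mul]
          ring
      _ ≤ (RW * (w₀ * H') + CW * (ν * H' + w₀ * S)) * E := by
          have h1 : μ' * ∑ u', |DG' u' - DG u'| * Wt u' ≤ RW := hrateDW x'
          have h2 : μ' * ∑ u', |DG u'| * Wt u' ≤ CW := by rw [hmoveAbs]; exact hmassDW x
          have h3 := mul_le_mul_of_nonneg_right h1 (by positivity : 0 ≤ w₀ * H')
          have h4 := mul_le_mul_of_nonneg_right h2 (by positivity : 0 ≤ ν * H' + w₀ * S)
          exact mul_le_mul_of_nonneg_right (by linarith) hE.le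
  calc |((L ^ 1 * L ^ k : ℕ) : ℝ) * (kingH L (L ^ 1 * L ^ k) U a m2 (k + 1) b (x' + unitVec (fine (L ^ 1 * L ^ k) U) μ)
            - kingH L (L ^ 1 * L ^ k) U a m2 (k + 1) b x')
          - ((L ^ k : ℕ) : ℝ) * (kingH L (L ^ k) U a m2 k b (x + unitVec (fine (L ^ k) U) μ) - kingH L (L ^ k) U a m2 k b x)|
        + |μ' * ∑ u', (DG' u' * w' u' * h' u' - DG u' * w (underPtN L k 1 U u') * h u')|
      ≤ D0 * E + (RW * (w₀ * H') + CW * (ν * H' + w₀ * S)) * E := add_le_add (hstep0 x') hsumle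
    _ = (D0 + RW * (w₀ * H') + CW * (ν * H' + w₀ * S)) * E := by ring

end GradStep

/-! ## §2 The undressed line 2 on the King-admissible tori, uniformly -/

section Undressed

open Real

variable (L : ℕ) [NeZero L]

/-- **KING'S PROP. 3.8 LINE 2 ON THE KING-ADMISSIBLE TORI, UNIFORMLY** (`0 ≤ γ < 1`, `n = 1`; the tree's `king_prop38_deriv_torus_blocks` BY NAME, its
`K`-dependent constant majorised by n18's `douterRate_le_unif`): `∃ δ C > 0` with
`|N′·(ℋ_{k+1}(x′+e_μ, b) − ℋ_{k+1}(x′, b)) − N·(ℋ_k(x+e_μ, b) − ℋ_k(x, b))| ≤ C·(L^{−γ∕2})^k·e^{−δ|B(x′) − b|}` for every volume exponent, `k ≥ 1`,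
block, direction and fine point `x′` (`x` under it). [cite: King1986, Prop. 3.8 (3.71) p.664 (second line)] -/
theorem dkingH_step_kingU (hLodd : Odd L) (hL : 2 ≤ L) {a m2 : ℝ} (ha : 0 < a) (hm : 0 < m2) {γ : ℝ} (hγ0 : 0 ≤ γ) (hγ1 : γ < 1) :
    ∃ δ C : ℝ, 0 < δ ∧ 0 < C ∧ ∀ (e k : ℕ), 1 ≤ k → ∀ (b : Tor (kingU d L e)) (μ : Fin (d + 1))
      (x' : Tor (fine (L ^ 1 * L ^ k) (kingU d L e))),
      |((L ^ 1 * L ^ k : ℕ) : ℝ) * (kingH L (L ^ 1 * L ^ k) (kingU d L e) a m2 (k + 1) b (x' + unitVec (fine (L ^ 1 * L ^ k) (kingU d L e)) μ)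
            - kingH L (L ^ 1 * L ^ k) (kingU d L e) a m2 (k + 1) b x')
        - ((L ^ k : ℕ) : ℝ) * (kingH L (L ^ k) (kingU d L e) a m2 k b (underPtN L k 1 (kingU d L e) x' + unitVec (fine (L ^ k) (kingU d L e)) μ)
            - kingH L (L ^ k) (kingU d L e) a m2 k b (underPtN L k 1 (kingU d L e) x'))|
        ≤ C * ((L : ℝ) ^ (-(γ / 2))) ^ k * Real.exp (-(δ * tdistT (kingU d L e) (blockOf (L ^ 1 * L ^ k) (kingU d L e) x') b)) := by
  have hL1 : 1 < L := by omega
  obtain ⟨δ₀, c₀, hδ₀, hc₀, H⟩ := king_prop38_deriv_torus_blocks (d + 1) L (Nat.succ_pos d) hLodd hL ha hm hγ0 hγ1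
  set Cu : ℝ := dprop38RateConst a a (a * (2 * ((a * (1 - ((L : ℝ) ^ 2)⁻¹))⁻¹ + π ^ 2 / 48 + 1 / 3)))
      ((π ^ 2 / 4) ^ (d + 1)) (d + 1) γ + dprop38PosConst a ((π ^ 2 / 4) ^ (d + 1)) (d + 1) γ with hCu
  refine ⟨δ₀ / 2, Real.sqrt (2 * (a * c₀) * Cu) + 1, half_pos hδ₀, by positivity, fun e k hk b μ x' => ?_⟩
  have hj := H ⟨d + 1, L, e + 1, k, Nat.succ_pos d, hLodd, hL1⟩ rfl rfl hk 1 le_rfl (kingU d L e) (kingU_eq_sitesPerDir L hLodd hL e k)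
    (underPtN L k 1 (kingU d L e) x') x' b (val_underPtN L k 1 (kingU d L e) x') μ
  set s : ℝ := (L : ℝ) ^ (-(γ / 2)) with hs_def
  have hs : 0 ≤ s := Real.rpow_nonneg (Nat.cast_nonneg _) _
  set E : ℝ := Real.exp (-(δ₀ / 2 * tdistT (kingU d L e) (blockOf (L ^ 1 * L ^ k) (kingU d L e) x') b)) with hE
  rw [blockOf_underPtN] at hj
  have hC := douterRate_le_unif (d := d + 1) (Nat.succ_pos d) ha hL hk (le_refl 1) hγ1 hc₀.le (K := k)
  refine hj.trans ?_
  calc Real.sqrt ((dprop38RateConst a a (lemma43Const a L k 1) ((π ^ 2 / 4) ^ (d + 1)) (d + 1) γ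
            + dprop38PosConst a ((π ^ 2 / 4) ^ (d + 1)) (d + 1) γ) * ((L ^ k : ℕ) : ℝ) ^ (-γ) * (2 * (a * c₀))) * E
      ≤ Real.sqrt (2 * (a * c₀) * Cu) * s ^ k * E := mul_le_mul_of_nonneg_right hC (Real.exp_pos _).le
    _ ≤ (Real.sqrt (2 * (a * c₀) * Cu) + 1) * s ^ k * E :=
        mul_le_mul_of_nonneg_right (mul_le_mul_of_nonneg_right (by linarith) (pow_nonneg hs _)) (Real.exp_pos _).le

end Undressed

end Summit.QuantumFields.YangMills.BalabanUVNodes.N15.KingModel
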